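import Mathlib
import HarnessLib
import Summits.FinalStateConjecture.Statement
import Literature.Geometry.Lorentzian.LandauLifshitzPseudotensor
import Literature.Geometry.Lorentzian.MinkowskiGlobalHyperbolicity

/-!
# Route EIHFluxBalance — `InertialRecession`, re-charting: late points of the exterior region lie
# outside every painted horizon — form for the GUARANTEED-REGION lab-time causality clause (r6)

Helper file for the crux `stmt-FinalStateConjecture-10166`
(`Summit.FinalStateConjecture.FinalStateConjecture.Theses.EIHFluxBalance.InertialRecession`),
line `sublinear-is-free-clean-window-charges`, stub `stub_rechart` (reshape r6).

Reshape r6 restricts the lab-time causality clause `H_time′` to points of the GUARANTEED region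
`{τ₁ < x⁰ ∧ ∀ i, rinᵢ < painted rᵢ(x)}` (the antecedent's `U` is existential and may be larger
than the region it is obliged to contain). This file re-proves `F1` of the causal transfer
(`painted_exterior_of_mem_exterior`, file `…StubRechartHorizon`, stated there for the unrestricted
clause) under the restricted clause: a point `Φ x` of `O` with `x` in the guaranteed region and
`x⁰ > max τ₀ τ₁` has painted radius `> r₊ᵢ` for every `i` — the slab point `Φ y` produced by
exhaustion lies in the painted exterior, hence in the guaranteed region because `rinᵢ < r₊ᵢ`
(`painted_exterior_of_mem_exterior_guaranteed'`, registered one-line form unprimed).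
[folklore causal bookkeeping]
-/

noncomputable section

set_option linter.dupNamespace false

open Set Filter Function Topology TopologicalSpace Literature.Geometry.Lorentzian
open scoped Manifold

namespace Summit.FinalStateConjecture.FinalStateConjecture.Theorems.SublinearIsFree.Rechart

/-- `J⁻(S)` is the union of the `J⁻` of the points of `S` (local copy of the lemma of file
`…StubRechartHorizon`, kept private to keep this file independent of it). [folklore] -/
private theorem mem_causalPast_iff_exists_aux {E : Type*} [NormedAddCommGroup E] [NormedSpace ℝ E]
    {H : Type*} [TopologicalSpace H] {I : ModelWithCorners ℝ E H} {n : WithTop ℕ∞}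
    {M : Type*} [TopologicalSpace M] [ChartedSpace H M] [IsManifold I ((⊤ : ℕ∞) : WithTop ℕ∞) M]
    {g : LorentzianMetric I n M} {tor : TimeOrientation g} {S : Set M} {p : M} :
    p ∈ g.causalPast tor S ↔ ∃ q ∈ S, p ∈ g.causalPast tor {q} := by
  unfold LorentzianMetric.causalPast
  rw [LorentzianMetric.causalFuture_eq_biUnion]
  simp only [mem_iUnion, exists_prop]

section F1

variable {X : Type} [TopologicalSpace X] [ChartedSpace E3 X]
  [IsManifold (𝓡 3) ((⊤ : ℕ∞) : WithTop ℕ∞) X] [ConnectedSpace X]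
  {D : InitialDataSet (𝓡 3) X}

/-- **Late guaranteed points of the exterior region lie outside every painted horizon** (lab-time
causality assumed on the guaranteed region only). See the module docstring. [folklore] -/
theorem painted_exterior_of_mem_exterior_guaranteed' (𝒟 : VacuumCauchyDevelopment D) {N : ℕ}
    (M a rin : Fin N → ℝ) (Λ : Fin N → ℝ → lorentzGroup) (ξ : Fin N → ℝ → E3) (τ₀ τ₁ : ℝ)
    (U : Opens E4) (Φ : U → 𝒟.carrier) (O : Set 𝒟.carrier)
    (hrin : ∀ i, rin i < Kerr.rPlus (M i) (a i))
    (hinj : InjOn Φ {x : U | τ₀ < x.1 0})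
    (hexh : ∀ t₁ : ℝ, τ₀ < t₁ → O \ Φ '' {x : U | t₁ < x.1 0 ∧ ∀ i, Kerr.rPlus (M i) (a i) <
      Kerr.radius (a i) (poincareInv (Λ i (x.1 0)) (E4.ofTimeSpace (x.1 0) (ξ i (x.1 0))) x.1)} ⊆
      𝒟.metric.causalPast 𝒟.timeOrientation (Φ '' {x : U | x.1 0 = t₁ ∧ ∀ i,
        Kerr.rPlus (M i) (a i) < Kerr.radius (a i) (poincareInv (Λ i (x.1 0))
          (E4.ofTimeSpace (x.1 0) (ξ i (x.1 0))) x.1)}))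
    (htime : ∀ x y : U, (τ₁ < x.1 0 ∧ ∀ i, rin i < Kerr.radius (a i) (poincareInv (Λ i (x.1 0))
        (E4.ofTimeSpace (x.1 0) (ξ i (x.1 0))) x.1)) → (τ₁ < y.1 0 ∧ ∀ i, rin i <
        Kerr.radius (a i) (poincareInv (Λ i (y.1 0)) (E4.ofTimeSpace (y.1 0) (ξ i (y.1 0))) y.1)) →
      Φ y ∈ 𝒟.metric.causalFuture 𝒟.timeOrientation {Φ x} → x.1 0 ≤ y.1 0)
    (x : U) (hx₀ : τ₀ < x.1 0) (hx₁ : τ₁ < x.1 0)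
    (hxg : ∀ i, rin i < Kerr.radius (a i) (poincareInv (Λ i (x.1 0))
      (E4.ofTimeSpace (x.1 0) (ξ i (x.1 0))) x.1))
    (hxO : Φ x ∈ O) (i : Fin N) :
    Kerr.rPlus (M i) (a i) <
      Kerr.radius (a i) (poincareInv (Λ i (x.1 0)) (E4.ofTimeSpace (x.1 0) (ξ i (x.1 0))) x.1) := by
  by_contra hcon
  set t' : ℝ := (max τ₀ τ₁ + x.1 0) / 2 with ht'
  have hmax : max τ₀ τ₁ < x.1 0 := max_lt hx₀ hx₁
  have ht'₀ : τ₀ < t' := by rw [ht']; linarith [le_max_left τ₀ τ₁]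
  have ht'₁ : τ₁ < t' := by rw [ht']; linarith [le_max_right τ₀ τ₁]
  have ht'x : t' < x.1 0 := by rw [ht']; linarith
  have hnot : Φ x ∉ Φ '' {y : U | t' < y.1 0 ∧ ∀ j, Kerr.rPlus (M j) (a j) <
      Kerr.radius (a j) (poincareInv (Λ j (y.1 0)) (E4.ofTimeSpace (y.1 0) (ξ j (y.1 0))) y.1)} := by
    rintro ⟨y, hy, hyx⟩
    have hyl : τ₀ < y.1 0 := ht'₀.trans hy.1
    have hxy : y = x := hinj hyl hx₀ hyx
    subst hxy
    exact hcon (hy.2 i)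
  obtain ⟨q, ⟨y, hy, rfl⟩, hq⟩ := mem_causalPast_iff_exists_aux.mp (hexh t' ht'₀ ⟨hxO, hnot⟩)
  have hfut : Φ y ∈ 𝒟.metric.causalFuture 𝒟.timeOrientation {Φ x} :=
    LorentzianMetric.mem_causalPast_singleton_iff.mp hq
  have hy₁ : τ₁ < y.1 0 := by rw [hy.1]; exact ht'₁
  have hyg : ∀ j, rin j < Kerr.radius (a j) (poincareInv (Λ j (y.1 0))
      (E4.ofTimeSpace (y.1 0) (ξ j (y.1 0))) y.1) := fun j ↦ (hrin j).trans (hy.2 j)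
  have hle := htime x y ⟨hx₁, hxg⟩ ⟨hy₁, hyg⟩ hfut
  rw [hy.1] at hle
  linarith

end F1

/-- Registered sub-goal form (stub `painted_exterior_of_mem_exterior_guaranteed` of the crux item)
of `painted_exterior_of_mem_exterior_guaranteed'`. [folklore] -/
theorem painted_exterior_of_mem_exterior_guaranteed : open Literature.Geometry.Lorentzian Set Manifold in ∀ {X : Type} [TopologicalSpace X] [ChartedSpace E3 X] [IsManifold (𝓡 3) ((⊤ : ℕ∞) : WithTop ℕ∞) X] [ConnectedSpace X] {D : InitialDataSet (𝓡 3) X} (𝒟 : VacuumCauchyDevelopment D) {N : ℕ} (M a rin : Fin N → ℝ) (Λ : Fin N → ℝ → lorentzGroup) (ξ : Fin N → ℝ → E3) (τ₀ τ₁ : ℝ) (U : TopologicalSpace.Opens E4) (Φ : U → 𝒟.carrier) (O : Set 𝒟.carrier), (∀ i, rin i < Kerr.rPlus (M i) (a i)) → InjOn Φ {x : U | τ₀ < x.1 0} → (∀ t₁ : ℝ, τ₀ < t₁ → O \ Φ '' {x : U | t₁ < x.1 0 ∧ ∀ i, Kerr.rPlus (M i) (a i) < Kerr.radius (a i) (poincareInv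 (Λ i (x.1 0)) (E4.ofTimeSpace (x.1 0) (ξ i (x.1 0))) x.1)} ⊆ 𝒟.metric.causalPast 𝒟.timeOrientation (Φ '' {x : U | x.1 0 = t₁ ∧ ∀ i, Kerr.rPlus (M i) (a i) < Kerr.radius (a i) (poincareInv (Λ i (x.1 0)) (E4.ofTimeSpace (x.1 0) (ξ i (x.1 0))) x.1)})) → (∀ x y : U, (τ₁ < x.1 0 ∧ ∀ i, rin i < Kerr.radius (a i) (poincareInv (Λ i (x.1 0)) (E4.ofTimeSpace (x.1 0) (ξ i (x.1 0))) x.1)) → (τ₁ < y.1 0 ∧ ∀ i, rin i < Kerr.radius (a i) (poincareInv (Λ i (y.1 0)) (E4.ofTimeSpace (y.1 0) (ξ i (y.1 0))) y.1)) → Φ y ∈ 𝒟.metric.causalFuture 𝒟.timeOrientation {Φ x} → x.1 0 ≤ y.1 0) → ∀ x : U, τ₀ < x.1 0 → τ₁ < x.1 0 → (∀ i, rin i < Kerr.radius (a i) (poincareInv (Λ i (x.1 0)) (E4.ofTimeSpace (x.1 0) (ξ i (x.1 0))) x.1)) → Φ x ∈ O → ∀ i : Fin N, Kerr.rPlus (M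 i) (a i) < Kerr.radius (a i) (poincareInv (Λ i (x.1 0)) (E4.ofTimeSpace (x.1 0) (ξ i (x.1 0))) x.1) :=
  fun 𝒟 ↦ painted_exterior_of_mem_exterior_guaranteed' 𝒟

end Summit.FinalStateConjecture.FinalStateConjecture.Theorems.SublinearIsFree.Rechart

end
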